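import Summits.CriticalPhenomena.SAWScalingLimit.Theorems.SAWDefectDecoherenceObservableToSLERNestedLinkDefs
import HarnessLib

/-!
# Band-wise renewal vocabulary for the abundance residue of `ObservableToSLE` / `ObservableToSLER`

Definitions ONLY (no statement of the line is asserted here), for the crux
`Summit.CriticalPhenomena.SAWScalingLimit.Theses.SAWDevelopingMap.ObservableToSLE` (item stmt-CriticalPhenomena-10472,
`Iff.rfl`-identical to stmt-CriticalPhenomena-14005), line `six-class-type-ladder`, reshape r15 of the lead c6.

After r13/r14 the crux is closed modulo three research inputs, the hardest being the ABUNDANCE of widely linked first good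
gates for fat co-oriented solid tame nested designer families (item stmt-CriticalPhenomena-17698, asked conditionally in r14).
The twin strategists' census (Cruxes/ObservableToSLER/STRATEGY-CENSUS-s5a.md §T5.2/§D5.2, idea `bandwise-renewal-density`)
shows that abundance is a DENSITY statement: a fixed level is singly crossed with probability `→ 0`, so it must be proved per
scale-BAND over lattice-dense levels, uniformly over pasts confined inside the band, and iterated over bands separated by the
protection radii that `NoMacroBacktracking` supplies.  This file fixes the vocabulary of that cut:

* `ClassWindows`, `FatUnderWindowK`, `FatSpine`, `FatAnchoredCoOrientedSolid` — the designer clauses of item 17698 (one-end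
  forms; so far only inlined in item signatures and crux skeletons), verbatim;
* `ZEscape` — a `ρ/4`-wide escape from a gate window to a fixed interior base point `z₀`, avoiding the level and staying
  `Rfar`-far from the other marked point (two such escapes concatenate to a `WideLink`);
* `BandFamily` — ONE band of designer levels at a lattice root: nested, eventually constant, containing the closed inner ball,
  inside the closed outer ball, lattice-connected, `≤ N` hexagons each, exterior-anchored, class-`j` clean windows only, fat
  bodies, fat spines, and a `z₀`-escape from every clean window;
* `BandSuccess` — the ADAPTED success of a vertex list at a band: a clean first exit from some level, not followed by a return
  to that level before the list first reaches distance `≥ P` (the protection radius) from the root;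
* `BandBoundAt` — the per-band renewal bound at one end, UNIFORM over self-avoiding pasts inside the inner ball, for the
  conditional (carved) law of the future;
* `BandRenewal` — both ends, one common window class `j` and one common base point `z₀`;
* `NoMacroBacktrackingAt` — the no-macroscopic-backtracking statement of r14 (`stub_noMacroBacktracking`) with its outer
  quantifier exposed.

Design choices (recorded for refuters and for the prover of `BandRenewal`).  (1) Pasts are quantified UNIVERSALLY among
self-avoiding walks confined to the closed inner ball (tip included): the iteration feeds the prefix up to the first exit
from the ball of HALF the inner radius, so nothing adaptive is hidden in the hypothesis.  (2) The failure constant `c₀ < 1`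
is uniform in the scales `R, P, ρin, ρ` below the prover's own threshold `R₂`: the iteration places its bands at scales
dictated by `NoMacroBacktracking`, which it does not control, so a scale-dependent constant could not be consumed; item
17698 itself needs only non-summable band successes — uniformity in the scale is the one identified strengthening.  (3) The
protection radius `P` may exceed the band by any factor: success asks for no return to the exited level before distance `P`
is reached, which in the continuum shadow is implied by a GLOBAL single crossing of a radius in the band (void probability of
the 3/4-stable regenerative set over `[ρin, θρin]`, a constant `< 1` by scaling), hence plausibly bounded uniformly in `P`.
(4) Escapes end at a common base point `z₀` and stay `2R`-far from the other mark, so that two escapes concatenate to the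
`WideLink` of item 17698 deterministically (`wideLink_of_zEscape`); the designer simply places no clean window where no such
escape exists.  (5) No closed `Prop` is defined here (no statement of the line or of an item is restated): every definition
is a predicate with parameters.

Sources: H. Kesten, J. Math. Phys. 4 (1963) §4; T. Alberts, H. Duminil-Copin, arXiv:0909.0203 Thm 1.2/1.3 (bridge heights of
the 5/8-restriction measure: a 3/4-stable regenerative set); B. Dyhr et al., arXiv:1008.4321 §2; N. Beaton et al.,
arXiv:1109.0358 Lemma 11 / Thm 10 (`B_T(x_c) → 0`); H. Duminil-Copin, S. Smirnov, Ann. of Math. 175 (2012) §4.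
-/

noncomputable section

open scoped BigOperators Topology NNReal ENNReal Classical
open Filter Set MeasureTheory Metric
open Literature.Probability.LatticeModels (HexVertex hexGraph hexCenter triZeta Site)
open Literature.Probability.RandomPlanarGeometry
open Literature.Probability.RandomPlanarGeometry.SAW

namespace Summit.CriticalPhenomena.SAWScalingLimit.Theorems.ObservableToSLE.TypeLadder

open Summit.CriticalPhenomena.SAWScalingLimit.Theorems.ObservableToSLER.BridgeGate
  (hexBall HasCleanWindow carvedLaw rowOf)
open Summit.CriticalPhenomena.SAWScalingLimit.Theorems.ObservableToSLER.NestedGate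

/-! ### The designer clauses of item 17698, one end at a time -/

/-- **Class-`k` windows**: every clean flat `ρ`-window of every level of `S` is of orientation class `k` — the level lies
in the signed rows `rowOf k · ≤ rowOf k p` and the far side is the exact half-lattice `{rowOf k · ≥ rowOf k p + 1}` inside
the window ball. -/
def ClassWindows (k : Fin 6) (Ω : Set ℂ) (δ ρ : ℝ) (S : ℕ → Set HexVertex) : Prop :=
  ∀ (n : ℕ) (p q : HexVertex), HasCleanWindow Ω δ ρ (S n) p q →
    rowOf k q = rowOf k p + 1 ∧
      ∀ x : HexVertex, (δ : ℂ) * hexCenter x ∈ ball ((δ : ℂ) * hexCenter q) ρ →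
        (x ∈ S n ↔ rowOf k x ≤ rowOf k p)

/-- **Fat level body under every clean window, class-`k` form**: a compact connected body through the point at depth
`ρ/2` on the level side of the window and through the rescaled root `c`, whose closed `ρ/4`-neighbourhood (in rescaled
vertices) lies in the level. -/
def FatUnderWindowK (k : Fin 6) (Ω : Set ℂ) (δ ρ : ℝ) (S : ℕ → Set HexVertex) (c : HexVertex) : Prop :=
  ∀ (n : ℕ) (p q : HexVertex), HasCleanWindow Ω δ ρ (S n) p q →
    ∃ K : Set ℂ, IsCompact K ∧ IsConnected K ∧
      (δ : ℂ) * hexCenter q - ((ρ / 2 : ℝ) : ℂ) * Complex.I * triZeta ^ (k : ℕ) ∈ K ∧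
      (δ : ℂ) * hexCenter c ∈ K ∧
      ∀ v : HexVertex, Metric.infDist ((δ : ℂ) * hexCenter v) K ≤ ρ / 4 → v ∈ S n

/-- **Fat spine**: every level contains the closed `ρ/8`-neighbourhood (in rescaled vertices) of one compact connected spine
through the rescaled root, and every vertex of the level lies in a lattice hexagon inside the level dipping into the
`ρ/16`-neighbourhood of the spine (no dangling level pieces). -/
def FatSpine (δ ρ : ℝ) (S : ℕ → Set HexVertex) (c : HexVertex) : Prop :=
  ∀ i : ℕ, ∃ K : Set ℂ, IsCompact K ∧ IsConnected K ∧ (δ : ℂ) * hexCenter c ∈ K ∧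
    (∀ v : HexVertex, Metric.infDist ((δ : ℂ) * hexCenter v) K ≤ ρ / 8 → v ∈ S i) ∧
    (∀ v ∈ S i, ∃ (t w : HexVertex) (r : ℕ), v ∈ hexBall t r ∧ w ∈ hexBall t r ∧
      hexBall t r ⊆ S i ∧ Metric.infDist ((δ : ℂ) * hexCenter w) K ≤ ρ / 16)

/-- **The family constraint of item 17698** (`FatAnchoredCoOrientedSolid`, both ends): exterior-anchored levels and, for ONE
common class `j : Fin 6`, class-`j` windows, class-`j` fat bodies and fat spines at both ends.  (The unused arguments are the
locality scale and the complexity, fixed by the consumer's signature.) -/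
def FatAnchoredCoOrientedSolid : DobrushinDomain → (ℝ → HexVertex) → (ℝ → HexVertex) → ℝ → ℝ → ℝ → ℕ →
    (ℕ → Set HexVertex) → (ℕ → Set HexVertex) → Prop :=
  fun D a b δ ρ _ _ S T =>
    (∀ n, ExteriorAnchored D.carrier δ (S n) (a δ)) ∧
      (∀ n, ExteriorAnchored D.carrier δ (T n) (b δ)) ∧
      ∃ j : Fin 6,
        (ClassWindows j D.carrier δ ρ S ∧ ClassWindows j D.carrier δ ρ T) ∧
          FatUnderWindowK j D.carrier δ ρ S (a δ) ∧ FatUnderWindowK j D.carrier δ ρ T (b δ) ∧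
          FatSpine δ ρ S (a δ) ∧ FatSpine δ ρ T (b δ)

/-! ### Bands -/

/-- **`z₀`-escape** from the gate vertex `q`: a continuous path from within `ρ` of the rescaled `q` to the base point `z₀`,
every point of which has its closed `ρ/4`-ball inside `Ω`, is `ρ/4`-far from every rescaled vertex of the removed set `U`,
and is `Rfar`-far from the point `w` (the other marked point).  It is a `WideEscape` as soon as `z₀` is `2R`-far from the
root, and an escape at the other end read backwards continues it to a `WideLink`. -/
def ZEscape (Ω : Set ℂ) (δ ρ Rfar : ℝ) (z₀ w : ℂ) (U : Set HexVertex) (q : HexVertex) : Prop :=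
  ∃ (x : ℂ) (γ : Path x z₀), dist x ((δ : ℂ) * hexCenter q) ≤ ρ ∧
    ∀ t, closedBall (γ t) (ρ / 4) ⊆ Ω ∧ (∀ v ∈ U, ρ / 4 ≤ dist (γ t) ((δ : ℂ) * hexCenter v)) ∧
      Rfar ≤ dist (γ t) w

/-- **One band of designer levels** at the lattice root `c`, mesh `δ`, inner radius `ρin`, outer radius `ρout`, window radius
`ρ`, far radius `Rfar`, base point `z₀`, other mark `w`, complexity `N`, window class `j`: a nested, eventually constant
sequence of levels, each containing every vertex rescaled into the closed `ρin`-ball about the rescaled root (so every past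
confined there lies inside every level), contained in the closed `ρout`-ball, connected in the honeycomb lattice, a union of
at most `N` lattice hexagons, exterior-anchored; all clean `ρ`-windows of class `j`, fat bodies, fat spines; and a
`z₀`-escape from every clean window. -/
def BandFamily (Ω : Set ℂ) (δ ρin ρout ρ Rfar : ℝ) (z₀ w : ℂ) (N : ℕ) (j : Fin 6) (c : HexVertex)
    (S : ℕ → Set HexVertex) : Prop :=
  (∀ n, S n ⊆ S (n + 1)) ∧ (∃ n₀ : ℕ, ∀ n, n₀ ≤ n → S n = S n₀) ∧
    (∀ n, ∀ v : HexVertex, dist ((δ : ℂ) * hexCenter v) ((δ : ℂ) * hexCenter c) ≤ ρin → v ∈ S n) ∧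
    (∀ n, ∀ v ∈ S n, dist ((δ : ℂ) * hexCenter v) ((δ : ℂ) * hexCenter c) ≤ ρout) ∧
    (∀ n, (hexGraph.induce (S n)).Preconnected) ∧
    (∀ n, ∃ L : List (HexVertex × ℕ), L.length ≤ N ∧
      ∀ v : HexVertex, v ∈ S n ↔ ∃ tk ∈ L, v ∈ hexBall tk.1 tk.2) ∧
    (∀ n, ExteriorAnchored Ω δ (S n) c) ∧
    ClassWindows j Ω δ ρ S ∧ FatUnderWindowK j Ω δ ρ S c ∧ FatSpine δ ρ S c ∧
    (∀ (n : ℕ) (p q : HexVertex), HasCleanWindow Ω δ ρ (S n) p q → ZEscape Ω δ ρ Rfar z₀ w (S n) q)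

/-- **Adapted band success** of the vertex list `l` (a walk read from the root `c`) at the band family `S` with window radius
`ρ` and protection radius `P`: at some level `S n` the list makes its first exit through an edge `{p, q}` carrying a clean
`ρ`-window, and it does not return to `S n` before it first reaches distance `≥ P` from the rescaled root — i.e. every later
entry all of whose predecessors after the exit are still `P`-close to the root lies outside `S n`.  Decided by the list up to
its first `P`-far entry. -/
def BandSuccess (Ω : Set ℂ) (δ ρ P : ℝ) (S : ℕ → Set HexVertex) (c : HexVertex) (l : List HexVertex) : Prop :=
  ∃ (n m : ℕ) (p q : HexVertex), IsFirstExitFrom (S n) l m p q ∧ HasCleanWindow Ω δ ρ (S n) p q ∧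
    ∀ (k : ℕ) (hk : k < l.length), m ≤ k →
      (∀ (k' : ℕ) (hk' : k' < l.length), m ≤ k' → k' < k →
        dist ((δ : ℂ) * hexCenter (l[k']'hk')) ((δ : ℂ) * hexCenter c) < P) →
      l[k]'hk ∉ S n

/-- **The per-band renewal bound at one end** (root approximation `root`, target approximation `tgt`, other marked point `w`,
base point `z₀`, window class `j`): there are `c₀ < 1`, a band ratio `θ > 1` and `R₂ > 0` such that for every far radius
`R ≤ R₂`, protection radius `P ≤ R` and inner radius `ρin ≤ P/(2θ)` there is a window threshold `ρw` such that for every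
window radius `ρ ≤ ρw` some complexity `N` works eventually in the mesh: a band family on `[ρin, θ·ρin]` exists for which,
UNIFORMLY over self-avoiding pasts `ω₀` of the domain graph from the root confined to the closed `ρin`-ball (tip included),
the conditional law of the future — the carved law from the tip avoiding the other past vertices, to the target — gives the
failure of adapted band success of the concatenated list mass at most `c₀`. -/
def BandBoundAt (D : DobrushinDomain) (root tgt : ℝ → HexVertex) (w z₀ : ℂ) (j : Fin 6) : Prop :=
  ∃ c₀ < (1 : ℝ), ∃ θ > (1 : ℝ), ∃ R₂ > (0 : ℝ), ∀ R ∈ Set.Ioc (0 : ℝ) R₂, ∀ P ∈ Set.Ioc (0 : ℝ) R,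
    ∀ ρin ∈ Set.Ioc (0 : ℝ) (P / (2 * θ)), ∃ ρw > (0 : ℝ), ∀ ρ ∈ Set.Ioc (0 : ℝ) ρw, ∃ N : ℕ,
      ∀ᶠ δ : ℝ in 𝓝[>] 0,
        ∃ S : ℕ → Set HexVertex, BandFamily D.carrier δ ρin (θ * ρin) ρ (2 * R) z₀ w N j (root δ) S ∧
          ∀ (t : HexVertex) (ω₀ : (hexDomainGraph D.carrier δ).Walk (root δ) t), ω₀.IsPath →
            (∀ v ∈ ω₀.support, dist ((δ : ℂ) * hexCenter v) ((δ : ℂ) * hexCenter (root δ)) ≤ ρin) →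
            carvedLaw D.carrier δ {v | v ∈ ω₀.support ∧ v ≠ t} t (tgt δ)
                {η | ¬ BandSuccess D.carrier δ ρ P S (root δ) (ω₀.support ++ η.walk.support.tail)} ≤
              ENNReal.ofReal c₀

/-- **Band-wise renewal at both ends** of `(D; a, b)`: for ONE common window class `j` and ONE common base point `z₀ ∈ D`,
the per-band bound at the root `a` (target `b`, escapes far from `pt 1`) and at the root `b` (target `a`, escapes far from
`pt 0`). -/
def BandRenewal (D : DobrushinDomain) (a b : ℝ → HexVertex) : Prop :=
  ∃ j : Fin 6, ∃ z₀ ∈ D.carrier, BandBoundAt D a b (D.pt 1) z₀ j ∧ BandBoundAt D b a (D.pt 0) z₀ j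

/-- **No macroscopic backtracking in `(D; a, b)`** (the statement of r14's `stub_noMacroBacktracking`, outer quantifier
exposed): for every `R′ > 0` and `ε > 0` there is `r > 0` such that eventually in the mesh the walk visits a vertex within `r`
of `pt 0` AFTER a vertex at distance `≥ R′` from it — resp. a vertex at distance `≥ R′` from `pt 1` AFTER a vertex within `r`
of it — with probability `≤ ε` each. -/
def NoMacroBacktrackingAt (D : DobrushinDomain) (a b : ℝ → HexVertex) : Prop :=
  ∀ R' > (0 : ℝ), ∀ ε > (0 : ℝ), ∃ r > (0 : ℝ), ∀ᶠ δ : ℝ in 𝓝[>] 0,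
    hexSAWLaw D.carrier δ (a δ) (b δ)
        {γ | ∃ (l₁ l₂ : List HexVertex) (u v : HexVertex), γ.walk.support = l₁ ++ u :: l₂ ∧ v ∈ l₂ ∧
          R' ≤ dist ((δ : ℂ) * hexCenter u) (D.pt 0) ∧ dist ((δ : ℂ) * hexCenter v) (D.pt 0) ≤ r} ≤
      ENNReal.ofReal ε ∧
    hexSAWLaw D.carrier δ (a δ) (b δ)
        {γ | ∃ (l₁ l₂ : List HexVertex) (u v : HexVertex), γ.walk.support = l₁ ++ u :: l₂ ∧ v ∈ l₂ ∧
          dist ((δ : ℂ) * hexCenter u) (D.pt 1) ≤ r ∧ R' ≤ dist ((δ : ℂ) * hexCenter v) (D.pt 1)} ≤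
      ENNReal.ofReal ε

/-! ### Bookkeeping lemmas (sanity of the vocabulary; used by the band iteration) -/

/-- Registered carrier `stub_bandDefs_room` (crux item stmt-CriticalPhenomena-10472, reshape r15): for a band ratio `θ > 1`
and a protection radius `P > 0` the admissible inner radii `(0, P/(2θ)]` form a nonempty interval, and the band on the
largest one, `[P/(2θ), P/2]`, ends at half the protection radius — the room the band iteration uses to place a band under its
protection radius. -/
theorem stub_bandDefs_room : ∀ θ P : ℝ, 1 < θ → 0 < P → 0 < P / (2 * θ) ∧ θ * (P / (2 * θ)) = P / 2 := by
  intro θ P hθ hP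
  have hθ0 : 0 < θ := lt_trans one_pos hθ
  refine ⟨by positivity, ?_⟩
  field_simp

/-- A `z₀`-escape is a wide escape to distance `2R` from the root as soon as the base point is `2R`-far from the rescaled
root. -/
theorem wideEscape_of_zEscape {Ω : Set ℂ} {δ ρ Rfar R : ℝ} {z₀ w : ℂ} {U : Set HexVertex} {c q : HexVertex}
    (h : ZEscape Ω δ ρ Rfar z₀ w U q) (hz : 2 * R ≤ dist z₀ ((δ : ℂ) * hexCenter c)) :
    WideEscape Ω δ ρ R U c q := by
  obtain ⟨x, γ, hx, hγ⟩ := h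
  exact ⟨x, z₀, γ, hx, hz, fun t => ⟨(hγ t).1, (hγ t).2.1⟩⟩

/-- Two `z₀`-escapes, at the two ends, concatenate to a wide link between the two gate windows, provided each removed set is
`(Rfar - ρ/4)`-close to the marked point the OTHER escape stays `Rfar`-far from. -/
theorem wideLink_of_zEscape {Ω : Set ℂ} {δ ρ Rfar : ℝ} {z₀ w w' : ℂ} {U U' : Set HexVertex} {q q' : HexVertex}
    (h : ZEscape Ω δ ρ Rfar z₀ w U q) (h' : ZEscape Ω δ ρ Rfar z₀ w' U' q')
    (hU' : ∀ v ∈ U', dist ((δ : ℂ) * hexCenter v) w ≤ Rfar - ρ / 4)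
    (hU : ∀ v ∈ U, dist ((δ : ℂ) * hexCenter v) w' ≤ Rfar - ρ / 4) :
    WideLink Ω δ ρ (U ∪ U') q q' := by
  obtain ⟨x, γ, hx, hγ⟩ := h
  obtain ⟨x', γ', hx', hγ'⟩ := h'
  refine ⟨x, x', γ.trans γ'.symm, hx, hx', fun t => ?_⟩
  have hmem : (γ.trans γ'.symm) t ∈ Set.range γ ∪ Set.range γ' := by
    have := Set.mem_range_self (f := γ.trans γ'.symm) t
    rw [Path.trans_range] at this
    rcases this with h1 | h1
    · exact Or.inl h1
    · right
      obtain ⟨s, hs⟩ := h1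
      exact ⟨unitInterval.symm s, hs⟩
  rcases hmem with ⟨s, hs⟩ | ⟨s, hs⟩
  · rw [← hs]
    refine ⟨(hγ s).1, fun v hv => ?_⟩
    rcases hv with hv | hv
    · exact (hγ s).2.1 v hv
    · have h1 := (hγ s).2.2
      have h2 := hU' v hv
      have h3 := dist_triangle (γ s) ((δ : ℂ) * hexCenter v) w
      rw [dist_comm ((δ : ℂ) * hexCenter v) w] at h3
      rw [dist_comm] at h2
      linarith
  · rw [← hs]
    refine ⟨(hγ' s).1, fun v hv => ?_⟩
    rcases hv with hv | hv
    · have h1 := (hγ' s).2.2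
      have h2 := hU v hv
      have h3 := dist_triangle (γ' s) ((δ : ℂ) * hexCenter v) w'
      rw [dist_comm ((δ : ℂ) * hexCenter v) w'] at h3
      rw [dist_comm] at h2
      linarith
    · exact (hγ' s).2.1 v hv

end Summit.CriticalPhenomena.SAWScalingLimit.Theorems.ObservableToSLE.TypeLadder

end
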